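/-
Copyright: H21 programme, solo seat `solo-RiemannHypothesis-informed` (session 5).
-/
import Summits.RiemannHypothesis.RiemannHypothesis.Theorems.SoloInformedDodgeNorms
import Summits.RiemannHypothesis.RiemannHypothesis.Theorems.SoloInformedClusterThreshold

/-!
# Bounded-cluster visibility (solo-informed, T25)

The double-log visibility theorem T16 (`SoloInformedEffDoubleLog`) sees an off-line pair
`ρ₀, ρ₁ = ½ ± η + iγ₀` at the window `a = c + 1` provided every OTHER zero with `|Im ρ − γ₀| < R`
lies on the critical line.  Here that local hypothesis is relaxed to: the other off-line zeros in
the window form a finite cluster `S'` with `|S'| ≤ N`, radius `‖ρ − (½ + iγ₀)‖ ≤ R₀` and distance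
`≥ δ` from `ρ₀` and `ρ₁`.  Each member `ρ ∈ S'` is DODGED EXACTLY by the complex dodge
`D_{τ_ρ}`, `τ_ρ = i(ρ − ½ − iγ₀)` (`clusterShift`): the symbol `−(s − iγ₀ − ½)² − τ_ρ²` of the
`γ₀`-twisted transform vanishes at `s = ρ` whatever the multiplicity of `ρ`, and at the pair it
equals `(ρ − ρ₀)(ρ − ρ₁)` (`clusterSymbol_eq`), of modulus `≥ δ²`.  The derivative norms of the
dodged dipole grow by at most `∏ (1 + ‖τ_ρ‖²) ≤ (1 + R₀²)^N` (`SoloInformedDodgeNorms`), so with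
`K_N(ψ, R₀) = 16·A₁·((1 + R₀²)^N B_{2N+4}(ψ))² + 1` (`clusterK`, `A₁ = zetaDensityConst`,
`B_m = bumpNormSum`):

* (`SoloInformedClusterThreshold`, T12/T13 for clusters) the local visibility inequality for ANY
  odd test whose twisted transform vanishes on `S'`, the local hypothesis exempting the pair and `S'`;
* `weilMellin_clusterDodges_twist_eq_zero`, `clusterSymbol_eq`, `pow_le_norm_clusterSymbol`: the
  cluster dodge kills the twisted transform on `S'` and multiplies the pair gain by
  `|∏_{ρ∈S'} (ρ − ρ₀)(ρ − ρ₁)|² ≥ δ^{4|S'|}`;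
* `weilGroundEnergy_neg_of_local_cluster_eff` (**T25**): for `ψ ≥ 0` smooth on `[−1, 1]`,
  `0 < η < ½`, `c ≥ 0`, `R ≥ 1`, `e^{c+1} ≤ R²`, `0 < δ ≤ 1`, `ζ(ρ₀) = 0`, off-line zeros in the
  window `⊆ {ρ₀, ρ₁} ∪ S'` with `S'` as above, `Φ(−η) ≤ e^{ηc}Φ(η)` and
  `K_N log(|γ₀| + 2) < η⁴ δ^{4N} (e^{ηc}Φ(η) − Φ(−η))²`  ⟹  `ε(c + 1) < 0`.

So a bounded, non-coalescing cluster of off-line companions does not hide an off-line zero from the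
Weil ground state: the window grows only by `(2N log(1/δ) + N log(1 + R₀²) + O_ψ(log N))/η`
(`SoloInformedClusterWindow`).  What remains invisible to this method is exactly an UNBOUNDED or
COALESCING local configuration of off-line zeros (sharpest statement §2e (D9)).
-/

open MeasureTheory Complex Set Filter Topology Literature.NumberTheory.LFunctions
open scoped ContDiff ComplexConjugate

namespace Summit.RiemannHypothesis.RiemannHypothesis.Theorems

/-! ## The cluster dodge -/

/-- The dodge ordinate that kills the twisted symbol at `ρ`: `τ_ρ = i(ρ − ½ − iγ₀)`. -/
noncomputable def clusterShift (γ₀ : ℝ) (ρ : ℂ) : ℂ := I * (ρ - 1 / 2 - γ₀ * I)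

/-- The list of dodge ordinates of a finite cluster. -/
noncomputable def clusterList (γ₀ : ℝ) (S' : Finset ℂ) : List ℂ := S'.toList.map (clusterShift γ₀)

/-- `|clusterList γ₀ S'| = |S'|`. -/
theorem length_clusterList (γ₀ : ℝ) (S' : Finset ℂ) : (clusterList γ₀ S').length = S'.card := by
  simp [clusterList]

/-- The twisted transform of an iterated dodge: the symbol `∏_{τ ∈ L} (−(s − iγ₀ − ½)² − τ²)`
comes out. -/
theorem weilMellin_weilDodges_twist {h : ℝ → ℂ} (hh : IsWeilTest h) (L : List ℂ) (γ₀ : ℝ)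
    (s : ℂ) :
    weilMellin (fun t ↦ weilDodges L h t * cexp (-(γ₀ * I) * t)) s =
      (L.map fun τ ↦ (-(s - γ₀ * I - 1 / 2) ^ 2 - τ ^ 2)).prod *
        weilMellin (fun t ↦ h t * cexp (-(γ₀ * I) * t)) s := by
  rw [weilMellin_mul_cexp, weilMellin_mul_cexp, weilMellin_weilDodges hh L]
  have e : (fun τ : ℂ ↦ (-(s + -(γ₀ * I) - 1 / 2) ^ 2 - τ ^ 2)) =
      fun τ ↦ (-(s - γ₀ * I - 1 / 2) ^ 2 - τ ^ 2) := by
    funext τ; ring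
  rw [e]

/-- **Exact dodging of the cluster.**  The twisted transform of `D_{clusterList} h` vanishes at
every `ρ ∈ S'` (whatever the multiplicity of `ρ` as a zero of anything). -/
theorem weilMellin_clusterDodges_twist_eq_zero {h : ℝ → ℂ} (hh : IsWeilTest h) (γ₀ : ℝ)
    (S' : Finset ℂ) {ρ : ℂ} (hρ : ρ ∈ S') :
    weilMellin (fun t ↦ weilDodges (clusterList γ₀ S') h t * cexp (-(γ₀ * I) * t)) ρ = 0 := by
  rw [weilMellin_weilDodges_twist hh]
  apply mul_eq_zero_of_left
  apply List.prod_eq_zero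
  refine List.mem_map.mpr ⟨clusterShift γ₀ ρ, ?_, ?_⟩
  · exact List.mem_map.mpr ⟨ρ, Finset.mem_toList.mpr hρ, rfl⟩
  · unfold clusterShift
    rw [mul_pow, I_sq]
    ring

/-- **The cluster symbol at the pair.**  At `s = ½ + u + iγ₀`:
`∏_{τ ∈ clusterList} (−u² − τ²) = ∏_{ρ ∈ S'} (ρ − (½ + u + iγ₀))(ρ − (½ − u + iγ₀))`. -/
theorem clusterSymbol_eq (γ₀ : ℝ) (S' : Finset ℂ) (u : ℂ) :
    ((clusterList γ₀ S').map fun τ ↦ (-u ^ 2 - τ ^ 2)).prod =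
      ∏ ρ ∈ S', (ρ - (1 / 2 + u + γ₀ * I)) * (ρ - (1 / 2 - u + γ₀ * I)) := by
  unfold clusterList
  rw [List.map_map, Finset.prod_map_toList]
  refine Finset.prod_congr rfl fun ρ _ ↦ ?_
  simp only [Function.comp_apply, clusterShift]
  rw [mul_pow, I_sq]
  ring

/-- **Separation bound.**  If every `ρ ∈ S'` is at distance `≥ δ ≥ 0` from `ρ₀` and `ρ₁`, the
cluster symbol at the pair has modulus `≥ δ^{2|S'|}`. -/
theorem pow_le_norm_clusterSymbol {η γ₀ δ : ℝ} (S' : Finset ℂ) (hδ : 0 ≤ δ)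
    (hsep : ∀ ρ ∈ S', δ ≤ ‖ρ - (1 / 2 + η + γ₀ * I)‖ ∧ δ ≤ ‖ρ - (1 / 2 - η + γ₀ * I)‖) :
    δ ^ (2 * S'.card) ≤
      ‖∏ ρ ∈ S', (ρ - (1 / 2 + η + γ₀ * I)) * (ρ - (1 / 2 - η + γ₀ * I))‖ := by
  rw [norm_prod, pow_mul, ← Finset.prod_const]
  refine Finset.prod_le_prod (fun _ _ ↦ by positivity) fun ρ hρ ↦ ?_
  rw [norm_mul, sq]
  exact mul_le_mul (hsep ρ hρ).1 (hsep ρ hρ).2 hδ (norm_nonneg _)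

/-! ## T25: bounded-cluster visibility -/

variable {ψ : ℝ → ℝ}

/-- The cluster constant `K_N(ψ, R₀) = 16·A₁·((1 + R₀²)^N · B_{2N+4}(ψ))² + 1`,
`A₁ = zetaDensityConst`, `B_m = bumpNormSum`. -/
noncomputable def clusterK (ψ : ℝ → ℝ) (N : ℕ) (R₀ : ℝ) : ℝ :=
  16 * zetaDensityConst * ((1 + R₀ ^ 2) ^ N * bumpNormSum ψ (2 * N + 4)) ^ 2 + 1

/-- `0 < K_N(ψ, R₀)`. -/
theorem clusterK_pos (ψ : ℝ → ℝ) (N : ℕ) (R₀ : ℝ) : 0 < clusterK ψ N R₀ := by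
  unfold clusterK
  have := zetaDensityConst_nonneg
  positivity

/-- **T25 (bounded-cluster visibility, effective).**  Let `ψ ≥ 0` be smooth with support in
`[−1, 1]`, `Φ = bumpLaplace ψ`, `0 < η < ½`, `γ₀ ≠ 0`, `c ≥ 0`, `R ≥ 1`, `e^{c+1} ≤ R²`,
`0 < δ ≤ 1`, and let `ρ₀ = ½ + η + iγ₀` be a zero of `ζ`.  Suppose the off-line zeros `ρ` of `ζ`
with `|Im ρ − γ₀| < R` all lie in `{ρ₀, ρ₁} ∪ S'`, where the finite set `S'` has `|S'| ≤ N`,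
radius `‖ρ − (½ + iγ₀)‖ ≤ R₀` and keeps distance `≥ δ` from `ρ₀` and `ρ₁ = ½ − η + iγ₀`.  If
`Φ(−η) ≤ e^{ηc} Φ(η)` and `K_N(ψ, R₀) · log(|γ₀| + 2) < η⁴ δ^{4N} (e^{ηc} Φ(η) − Φ(−η))²`, then
the Weil ground-state energy at the window `c + 1` is negative. -/
theorem weilGroundEnergy_neg_of_local_cluster_eff (hψ : ContDiff ℝ ∞ ψ)
    (hsupp : tsupport ψ ⊆ Icc (-1) 1) (hψ0 : ∀ s, 0 ≤ ψ s) (N : ℕ) (R₀ : ℝ) :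
    ∀ (η γ₀ c R δ : ℝ) (S' : Finset ℂ), 0 < η → η < 1 / 2 → γ₀ ≠ 0 → 0 ≤ c → 1 ≤ R →
      Real.exp (c + 1) ≤ R ^ 2 → 0 < δ → δ ≤ 1 →
      riemannZeta (1 / 2 + η + γ₀ * I) = 0 → S'.card ≤ N →
      (∀ ρ ∈ S', ‖ρ - (1 / 2 + γ₀ * I)‖ ≤ R₀ ∧ δ ≤ ‖ρ - (1 / 2 + η + γ₀ * I)‖ ∧
          δ ≤ ‖ρ - (1 / 2 - η + γ₀ * I)‖) →
      (∀ ρ : ℂ, riemannZeta ρ = 0 → 0 ≤ ρ.re → ρ.re ≤ 1 → |ρ.im - γ₀| < R → ρ.re ≠ 1 / 2 →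
          ρ = 1 / 2 + η + γ₀ * I ∨ ρ = 1 / 2 - η + γ₀ * I ∨ ρ ∈ S') →
      bumpLaplace ψ (-η) ≤ Real.exp (η * c) * bumpLaplace ψ η →
      (clusterK ψ N R₀ * Real.log (|γ₀| + 2) <
          η ^ 4 * δ ^ (4 * N) *
            (Real.exp (η * c) * bumpLaplace ψ η - bumpLaplace ψ (-η)) ^ 2) →
      weilGroundEnergy (c + 1) < 0 := by
  intro η γ₀ c R δ S' hη hη2 hγ hc hR hRa hδ hδ1 hζ hcard hclus hloc hgainpos hwin
  unfold clusterK at hwin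
  have hT := weilGroundEnergy_neg_of_local_oddTest_cluster
  set A₁ : ℝ := zetaDensityConst
  have hA₁ : 0 < A₁ := zetaDensityConst_pos
  set B : ℝ := bumpNormSum ψ (2 * N + 4) with hB_def
  have hB0 : 0 ≤ B := bumpNormSum_nonneg ψ _
  set Q : ℝ := (1 + R₀ ^ 2) ^ N * B with hQ_def
  have hQ0 : 0 ≤ Q := by positivity
  -- the test `k = D_0 D_{clusterList} h_c`
  set L : List ℂ := clusterList γ₀ S' with hL_def
  set w : ℝ → ℂ := weilDodges L (bumpDipole ψ c) with hw_def
  set k : ℝ → ℂ := weilDodge 0 w with hk_def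
  have hh : IsWeilTest (bumpDipole ψ c) := isWeilTest_bumpDipole hψ hsupp hc
  have hhodd : ∀ t, bumpDipole ψ c (-t) = -bumpDipole ψ c t := bumpDipole_odd ψ c
  have hhs : tsupport (bumpDipole ψ c) ⊆ Icc (-(c + 1)) (c + 1) :=
    tsupport_bumpDipole_subset hsupp hc
  have hw : IsWeilTest w := isWeilTest_weilDodges hh L
  have hwodd : ∀ t, w (-t) = -w t := weilDodges_odd hhodd L
  have hk : IsWeilTest k := isWeilTest_weilDodge hw 0
  have hkodd : ∀ t, k (-t) = -k t := weilDodge_odd hwodd 0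
  have hks : tsupport k ⊆ Icc (-(c + 1)) (c + 1) :=
    ((tsupport_weilDodge_subset 0 w).trans (tsupport_weilDodges_subset L _)).trans hhs
  have hk_eq : k = weilDodges (0 :: L) (bumpDipole ψ c) := rfl
  -- the gain of the undodged dipole
  set g : ℝ := Real.exp (η * c) * bumpLaplace ψ η - bumpLaplace ψ (-η) with hg_def
  have hg0 : 0 ≤ g := sub_nonneg.mpr hgainpos
  have hgain : g ≤ ‖∫ t, bumpDipole ψ c t * cexp ((η : ℂ) * t)‖ :=
    gain_bumpDipole hψ.continuous hsupp hψ0 hη.le hc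
  have hlog : 0 < Real.log (|γ₀| + 2) := Real.log_pos (by linarith [abs_nonneg γ₀])
  have hgpos : 0 < g := by
    rcases hg0.lt_or_eq with h | h
    · exact h
    · exfalso
      rw [← h] at hwin
      have : 0 < (16 * A₁ * Q ^ 2 + 1) * Real.log (|γ₀| + 2) := by positivity
      norm_num at hwin
      linarith
  have hint_ne : ∫ t, bumpDipole ψ c t * cexp ((η : ℂ) * t) ≠ 0 := by
    intro h0
    rw [h0, norm_zero] at hgain
    linarith
  -- the cluster symbol at the pair
  set Pη : ℂ := ∏ ρ ∈ S', (ρ - (1 / 2 + η + γ₀ * I)) * (ρ - (1 / 2 - η + γ₀ * I)) with hPη_def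
  have hPη : δ ^ (2 * S'.card) ≤ ‖Pη‖ :=
    pow_le_norm_clusterSymbol S' hδ.le fun ρ hρ ↦ ⟨(hclus ρ hρ).2.1, (hclus ρ hρ).2.2⟩
  have hPηN : δ ^ (2 * N) ≤ ‖Pη‖ := (pow_le_pow_of_le_one hδ.le hδ1 (by omega)).trans hPη
  have hPη0 : 0 < ‖Pη‖ := lt_of_lt_of_le (by positivity) hPηN
  have e1 : ∀ f : ℝ → ℂ, ∫ t : ℝ, f t * cexp ((η : ℂ) * t) = weilMellin f (1 / 2 + η) := by
    intro f; unfold weilMellin; congr 1 with t; congr 2; ring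
  have hsymb : (L.map fun τ ↦ (-((1 : ℂ) / 2 + η - 1 / 2) ^ 2 - τ ^ 2)).prod = Pη := by
    rw [hPη_def, ← clusterSymbol_eq γ₀ S' η, hL_def]
    have e : (fun τ : ℂ ↦ (-((1 : ℂ) / 2 + η - 1 / 2) ^ 2 - τ ^ 2)) =
        fun τ ↦ (-(η : ℂ) ^ 2 - τ ^ 2) := by
      funext τ; ring
    rw [e]
  have hw_int : ∫ t, w t * cexp ((η : ℂ) * t) =
      Pη * ∫ t, bumpDipole ψ c t * cexp ((η : ℂ) * t) := by
    rw [e1, e1, hw_def, weilMellin_weilDodges hh L, hsymb]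
  have hw_ne : ∫ t, w t * cexp ((η : ℂ) * t) ≠ 0 := by
    rw [hw_int]; exact mul_ne_zero (norm_pos_iff.mp hPη0) hint_ne
  have hpos : 0 < ∫ t, ‖k t‖ ^ 2 := integral_norm_sq_weilDodge_zero_pos hw hη.ne' hw_ne
  -- `|∫ k e^{ηt}|² = η⁴ ‖Pη‖² |∫ h_c e^{ηt}|²`
  have hnη : ‖(-((1 : ℂ) / 2 + η - 1 / 2) ^ 2 - (0 : ℂ) ^ 2)‖ = η ^ 2 := by
    have e : (-((1 : ℂ) / 2 + η - 1 / 2) ^ 2 - (0 : ℂ) ^ 2) = (((-(η ^ 2)) : ℝ) : ℂ) := by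
      push_cast; ring
    rw [e, Complex.norm_real, Real.norm_eq_abs, abs_neg, abs_of_nonneg (sq_nonneg η)]
  have hk_int : ‖∫ t, k t * cexp ((η : ℂ) * t)‖ ^ 2 =
      η ^ 4 * ‖Pη‖ ^ 2 * ‖∫ t, bumpDipole ψ c t * cexp ((η : ℂ) * t)‖ ^ 2 := by
    rw [e1 k, hk_def, weilMellin_weilDodge (contDiff_two_of_isWeilTest hw) hw.2, ← e1 w, hw_int,
      norm_mul, norm_mul, hnη]
    ring
  -- the list `0 :: L`: length and norm-inflation factor
  have hlen : (0 :: L).length = S'.card + 1 := by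
    rw [List.length_cons, hL_def, length_clusterList]
  have hprod : ((0 :: L).map fun τ ↦ 1 + ‖τ‖ ^ 2).prod ≤ (1 + R₀ ^ 2) ^ N := by
    rw [List.map_cons, List.prod_cons, norm_zero, hL_def]
    unfold clusterList
    rw [List.map_map, Finset.prod_map_toList]
    have e : ∏ ρ ∈ S', ((fun τ : ℂ ↦ 1 + ‖τ‖ ^ 2) ∘ clusterShift γ₀) ρ =
        ∏ ρ ∈ S', (1 + ‖ρ - (1 / 2 + γ₀ * I)‖ ^ 2) := by
      refine Finset.prod_congr rfl fun ρ _ ↦ ?_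
      simp only [Function.comp_apply, clusterShift, norm_mul, Complex.norm_I, one_mul]
      rw [show ρ - 1 / 2 - (γ₀ : ℂ) * I = ρ - (1 / 2 + γ₀ * I) by ring]
    rw [e]
    calc ((1 : ℝ) + 0 ^ 2) * ∏ ρ ∈ S', (1 + ‖ρ - (1 / 2 + γ₀ * I)‖ ^ 2)
        = ∏ ρ ∈ S', (1 + ‖ρ - (1 / 2 + γ₀ * I)‖ ^ 2) := by ring
      _ ≤ ∏ _ρ ∈ S', (1 + R₀ ^ 2) := by
          refine Finset.prod_le_prod (fun ρ _ ↦ by positivity) fun ρ hρ ↦ ?_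
          have h1 := (hclus ρ hρ).1
          nlinarith [norm_nonneg (ρ - (1 / 2 + γ₀ * I))]
      _ = (1 + R₀ ^ 2) ^ S'.card := Finset.prod_const _
      _ ≤ (1 + R₀ ^ 2) ^ N := pow_le_pow_right₀ (by nlinarith) hcard
  -- the `c`-independent norms of `k`
  have hnorm : ∀ j ≤ 2, ∫ t, ‖iteratedDeriv j k t‖ ≤ 2 * Q := by
    intro j hj
    have hjm : j + 2 * (0 :: L).length ≤ 2 * N + 4 := by rw [hlen]; omega
    calc ∫ t, ‖iteratedDeriv j k t‖
        = ∫ t, ‖iteratedDeriv j (weilDodges (0 :: L) (bumpDipole ψ c)) t‖ := by rw [hk_eq]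
      _ ≤ ((0 :: L).map fun τ ↦ 1 + ‖τ‖ ^ 2).prod * (2 * B) :=
          integral_norm_iteratedDeriv_weilDodges_bumpDipole_le hψ hsupp hc (2 * N + 4) (0 :: L) hjm
      _ ≤ (1 + R₀ ^ 2) ^ N * (2 * B) := mul_le_mul_of_nonneg_right hprod (by positivity)
      _ = 2 * Q := by rw [hQ_def]; ring
  have hk1 : ∫ t, ‖k t‖ ≤ 2 * Q := by simpa using hnorm 0 (by norm_num)
  have hk2 : ∫ t, ‖deriv k t‖ ≤ 2 * Q := by simpa using hnorm 1 (by norm_num)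
  have hk3 : ∫ t, ‖iteratedDeriv 2 k t‖ ≤ 2 * Q := hnorm 2 le_rfl
  have hMloc : ((∫ t, ‖k t‖) ^ 2 + (∫ t, ‖deriv k t‖) ^ 2)
      + 2 * Real.exp (c + 1) * (∫ t, ‖iteratedDeriv 2 k t‖) ^ 2 / R ^ (2 * 1)
        ≤ 4 * (Q ^ 2 + Q ^ 2 + 2 * Q ^ 2) :=
    local_majorant_arith (integral_nonneg fun _ ↦ norm_nonneg _)
      (integral_nonneg fun _ ↦ norm_nonneg _) (integral_nonneg fun _ ↦ norm_nonneg _) hk1 hk2 hk3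
      (Real.exp_pos _) (by simpa using hRa)
  have h1 : 2 * A₁ * (((∫ t, ‖k t‖) ^ 2 + (∫ t, ‖deriv k t‖) ^ 2)
      + 2 * Real.exp (c + 1) * (∫ t, ‖iteratedDeriv 2 k t‖) ^ 2 / R ^ (2 * 1))
        * Real.log (|γ₀| + 2)
      ≤ 2 * A₁ * (4 * (Q ^ 2 + Q ^ 2 + 2 * Q ^ 2)) * Real.log (|γ₀| + 2) :=
    mul_le_mul_of_nonneg_right (mul_le_mul_of_nonneg_left hMloc (by positivity)) hlog.le
  -- the zero has multiplicity `≥ 1`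
  have hne1 : (1 / 2 + η + γ₀ * I : ℂ) ≠ 1 := by
    intro h
    apply hγ
    have := congrArg Complex.im h
    simpa using this
  have hm1 : (1 : ℝ) ≤ (riemannZetaZeroOrder (1 / 2 + η + γ₀ * I) : ℝ) := by
    have := (riemannZetaZeroOrder_pos_iff hne1).mpr hζ
    have h1m : (1 : ℤ) ≤ riemannZetaZeroOrder (1 / 2 + η + γ₀ * I) := by omega
    exact_mod_cast h1m
  -- the gain of `k` dominates `η⁴ δ^{4N} g²`
  have hG : η ^ 4 * δ ^ (4 * N) * g ^ 2 ≤ ‖∫ t, k t * cexp ((η : ℂ) * t)‖ ^ 2 := by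
    rw [hk_int]
    have hP2 : δ ^ (4 * N) ≤ ‖Pη‖ ^ 2 := by
      rw [show 4 * N = 2 * N * 2 by ring, pow_mul]
      exact pow_le_pow_left₀ (by positivity) hPηN 2
    have hG2 : g ^ 2 ≤ ‖∫ t, bumpDipole ψ c t * cexp ((η : ℂ) * t)‖ ^ 2 :=
      pow_le_pow_left₀ hg0 hgain 2
    have hPG := mul_le_mul hP2 hG2 (sq_nonneg _) (sq_nonneg _)
    calc η ^ 4 * δ ^ (4 * N) * g ^ 2 = η ^ 4 * (δ ^ (4 * N) * g ^ 2) := by ring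
      _ ≤ η ^ 4 * (‖Pη‖ ^ 2 * ‖∫ t, bumpDipole ψ c t * cexp ((η : ℂ) * t)‖ ^ 2) :=
          mul_le_mul_of_nonneg_left hPG (by positivity)
      _ = η ^ 4 * ‖Pη‖ ^ 2 * ‖∫ t, bumpDipole ψ c t * cexp ((η : ℂ) * t)‖ ^ 2 := by ring
  have hmP := mul_le_mul_of_nonneg_right hm1 (sq_nonneg ‖∫ t, k t * cexp ((η : ℂ) * t)‖)
  have h2 : 2 * A₁ * (4 * (Q ^ 2 + Q ^ 2 + 2 * Q ^ 2)) * Real.log (|γ₀| + 2) <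
      2 * ((riemannZetaZeroOrder (1 / 2 + η + γ₀ * I) : ℝ)
        * ‖∫ t, k t * cexp ((η : ℂ) * t)‖ ^ 2) := by
    linarith [hwin, hG, hmP, hlog]
  -- the twisted transform of `k` vanishes on the cluster
  have hvan : ∀ ρ ∈ S', weilMellin (fun t ↦ k t * cexp (-(γ₀ * I) * t)) ρ = 0 := by
    intro ρ hρ
    rw [hk_eq, weilMellin_weilDodges_twist hh, List.map_cons, List.prod_cons]
    have h0 := weilMellin_clusterDodges_twist_eq_zero hh γ₀ S' hρ
    rw [weilMellin_weilDodges_twist hh, ← hL_def] at h0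
    rw [mul_assoc, h0, mul_zero]
  have key := hT k (c + 1) η γ₀ R 1 S' hk hkodd (by linarith) hR hks hpos hζ
    (abs_lt.mpr ⟨by linarith, hη2⟩) hη.ne' hγ hvan hloc
  exact key (lt_of_le_of_lt h1 h2)

end Summit.RiemannHypothesis.RiemannHypothesis.Theorems
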